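import Literature.Algebra.Homology.DiscreteRepTateDualityPrimary
import Literature.Algebra.Homology.DiscreteRepTrivialDuality
import Literature.Algebra.Homology.ExtDualityBiprod
import Mathlib.GroupTheory.Torsion
import HarnessLib

/-!
# Tate duality for ALL admissible finite modules from the `p`-primary engines: the primary
# decomposition `M ≅ M[ℓ^∞] ⊞ M'` in `C_Γ` and the induction over the primes of `#M`
# (Harari Thm. 16.21 / 17.18 for a `P`-class formation; Milne ADT I Thm. 1.8, Thm. 4.10 (a))

Topic `Algebra/Homology`; namespace `Literature.Algebra.Homology.DiscreteRep`.  One plumbing `def`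
(the splitting isomorphism) and theorems; no named fact, no instance, no notation, no `sorry`.

For a `P`-class formation (Harari Def. 16.24 (b), Thm. 17.2: `(G_S, C_S)`) Tate's duality theorem holds
for the finite modules whose order involves only primes of `P` (Harari Thm. 16.21 with Rem. 16.24,
Thm. 17.18; Milne I Thm. 1.8 as used in Thm. 4.10 (a): "`M` a finite `G_S`-module whose order is a unit
in `R_{K,S}`").  In the tree the duality is proved ONE PRIME AT A TIME — `tateDuality_finite_primary`
(`DiscreteRepTateDualityPrimary.lean`): under `TateDualityHypothesesAt p C inv`, for every finite `M`
killed by `p^k`, `α²(Γ, M)` and `α¹(Γ, M)` are bijective and `Ext³(M, C) = 0`.  This file assembles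
the per-prime statements into the statement for EVERY finite `M ∈ C_Γ` such that
`TateDualityHypothesesAt ℓ C inv` holds for every prime `ℓ ∣ #M` (`tateDuality_finite_of_primary`),
by the primary decomposition:

* §1 (any abelian category) `coprimeKernelIso`: for coprime `a, b` with `(a * b) • 𝟙 M = 0`,
  **`M ≅ kernel (a • 𝟙 M) ⊞ kernel (b • 𝟙 M)`** — the Bézout idempotents `(v b) • 𝟙`, `(u a) • 𝟙`
  (`u a + v b = 1`) split `M`; pure category algebra.
* §2 (in `C_Γ = DiscreteRepCat ℤ Γ`) carrier bookkeeping for `kernel (a • 𝟙 M)`: it is finite, killed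
  by `a`, its order divides `#M`, and it is a PROPER part of `M` as soon as some prime `ℓ ∣ #M` does
  not divide `a` (Cauchy).
* §3 **`tateDuality_finite_of_primary`** by strong induction on `#M`: `#M = 1` is a zero object;
  otherwise split off `M[ℓ^∞] = kernel (ℓ^{v_ℓ(#M)} • 𝟙 M)` (the engine at `ℓ`) from the coprime
  kernel (induction), and glue with door-c4's `adjointBijective_biprod_iff`,
  `adjointBijective_iff_of_iso`, `ext_biprod_eq_zero_iff`, `ext_eq_zero_of_iso`
  (`ExtDualityBiprod.lean`).

USE: background lane «PT-Ш-S-TC» of cell `bsd-eis` (crux `GoodLatticeBDPValue`,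
stmt-BirchSwinnertonDyer-19032), brick D5c: the finite-`S` Poitou–Tate target
`poitouTate_shaRestricted_tateDual_natural_at K S` quantifies over ALL finite modules `M` with
`supp #M ⊆ S`; the `S`-idèle class formation `(G_S, C̄_S)` is a `P`-class formation with `P ⊇ {ℓ : S ⊇ S_ℓ}`
and its engines are typed per prime (`TateDualityHypothesesAt ℓ`), so the Ext road is instantiated
ONCE for general `M` through this file.  HONEST FRAMING: homological bookkeeping over the per-prime
duality theorem; no arithmetic and no case of BSD is proved here.

## References
* D. Harari, *Galois Cohomology and Class Field Theory*, Universitext (2020), §16.3 Thm. 16.21 (proof: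
  reduction to `ℤ/ℓ^a` by direct sums), Rem. 16.24 (`P`-class formations), Thm. 17.18. [Harari2020]
* J. S. Milne, *Arithmetic Duality Theorems*, 2nd ed. (2006), I Thm. 1.8 and its proof (p. 22:
  additivity in `M`), I Thm. 4.10 (a) ("order a unit in `R_{K,S}`"). [MilneADT2006]
-/

noncomputable section

namespace Literature.Algebra.Homology

open CategoryTheory CategoryTheory.Limits CategoryTheory.Abelian ExtDuality

/-! ## §1 Splitting a module killed by `a * b`, `(a, b) = 1`, along the kernels of `a` and `b` -/

namespace CoprimeSplitting

variable {𝒞 : Type*} [Category 𝒞] [Abelian 𝒞] (M : 𝒞) {a b : ℕ} {u v : ℤ}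

/-- `((z : ℤ) • 𝟙 M) ≫ (n • 𝟙 M) = (z * n) • 𝟙 M`. [cite: Harari2020, §16.3 Theorem 16.21 (proof)] -/
theorem zsmul_id_comp_nsmul_id (z : ℤ) (n : ℕ) :
    (z • 𝟙 M) ≫ (n • 𝟙 M) = (z * n) • 𝟙 M := by
  rw [Preadditive.zsmul_comp, Category.id_comp, ← natCast_zsmul, smul_smul]

/-- If `(a * b) • 𝟙 M = 0` then `((v * b) • 𝟙 M) ≫ (a • 𝟙 M) = 0`: the Bézout idempotent for `a` lands
in `kernel (a • 𝟙 M)`. [cite: Harari2020, §16.3 Theorem 16.21 (proof)] -/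
theorem bezout_comp_eq_zero (hM : (a * b) • 𝟙 M = 0) (z : ℤ) :
    ((z * b) • 𝟙 M) ≫ (a • 𝟙 M) = 0 := by
  rw [zsmul_id_comp_nsmul_id, mul_assoc, ← smul_smul, ← Nat.cast_mul, natCast_zsmul, mul_comm,
    hM, smul_zero]

/-- The Bézout component `M ⟶ kernel (a • 𝟙 M)`, `x ↦ (v b) x`. [cite: Harari2020, §16.3 Theorem 16.21 (proof)] -/
abbrev toKernel (hM : (a * b) • 𝟙 M = 0) (v : ℤ) : M ⟶ kernel (a • 𝟙 M) :=
  kernel.lift (a • 𝟙 M) ((v * b) • 𝟙 M) (bezout_comp_eq_zero M hM v)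

/-- On `kernel (a • 𝟙 M)` the Bézout idempotent `(v b) • 𝟙` is the identity (`u a + v b = 1` and `a`
kills the kernel). [cite: Harari2020, §16.3 Theorem 16.21 (proof)] -/
theorem kernel_ι_comp_toKernel (hM : (a * b) • 𝟙 M = 0) (huv : u * a + v * b = 1) :
    kernel.ι (a • 𝟙 M) ≫ toKernel M hM v = 𝟙 _ := by
  rw [← cancel_mono (kernel.ι (a • 𝟙 M)), Category.assoc, kernel.lift_ι, Category.id_comp,
    Preadditive.comp_zsmul, Category.comp_id]
  have h0 : (a : ℤ) • kernel.ι (a • 𝟙 M) = 0 := by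
    rw [natCast_zsmul, ← Category.comp_id (kernel.ι (a • 𝟙 M)), ← Preadditive.comp_nsmul,
      kernel.condition]
  calc (v * b) • kernel.ι (a • 𝟙 M)
      = (1 - u * a) • kernel.ι (a • 𝟙 M) := by rw [← huv]; ring_nf
    _ = kernel.ι (a • 𝟙 M) := by rw [sub_smul, one_smul, ← smul_smul, h0, smul_zero, sub_zero]

/-- The cross term vanishes: `kernel (a • 𝟙 M) ↪ M → kernel (b • 𝟙 M)` is zero (`(u a) • ι_a = 0`).
[cite: Harari2020, §16.3 Theorem 16.21 (proof)] -/
theorem kernel_ι_comp_toKernel_eq_zero (hM : (b * a) • 𝟙 M = 0) :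
    kernel.ι (a • 𝟙 M) ≫ toKernel M hM u = 0 := by
  rw [← cancel_mono (kernel.ι (b • 𝟙 M)), Category.assoc, kernel.lift_ι, zero_comp,
    Preadditive.comp_zsmul, Category.comp_id, ← smul_smul, natCast_zsmul,
    ← Category.comp_id (kernel.ι (a • 𝟙 M)), ← Preadditive.comp_nsmul, kernel.condition, smul_zero]

/-- **`M ≅ kernel (a • 𝟙 M) ⊞ kernel (b • 𝟙 M)` for coprime `a, b` with `(a * b) • 𝟙 M = 0`** (Bézout
`u a + v b = 1`: the components are `(v b) • 𝟙` and `(u a) • 𝟙`, the inverse is `ι_a + ι_b`).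
[cite: Harari2020, §16.3 Theorem 16.21 (proof)][cite: MilneADT2006, I Theorem 1.8 (proof, p. 22)] -/
def coprimeKernelIso (hM : (a * b) • 𝟙 M = 0) (huv : u * a + v * b = 1) :
    M ≅ kernel (a • 𝟙 M) ⊞ kernel (b • 𝟙 M) where
  hom := biprod.lift (toKernel M hM v) (toKernel M ((mul_comm b a).symm ▸ hM) u)
  inv := biprod.desc (kernel.ι _) (kernel.ι _)
  hom_inv_id := by
    rw [biprod.lift_desc, kernel.lift_ι, kernel.lift_ι, ← add_smul,
      show v * (b : ℤ) + u * (a : ℤ) = 1 by rw [add_comm]; exact huv, one_smul]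
  inv_hom_id := by
    have hvu : v * (b : ℤ) + u * (a : ℤ) = 1 := by rw [add_comm]; exact huv
    apply biprod.hom_ext' <;> apply biprod.hom_ext
    · rw [biprod.inl_desc_assoc, Category.assoc, biprod.lift_fst, kernel_ι_comp_toKernel M hM huv,
        Category.comp_id, biprod.inl_fst]
    · rw [biprod.inl_desc_assoc, Category.assoc, biprod.lift_snd,
        kernel_ι_comp_toKernel_eq_zero M ((mul_comm b a).symm ▸ hM), Category.comp_id, biprod.inl_snd]
    · rw [biprod.inr_desc_assoc, Category.assoc, biprod.lift_fst,
        kernel_ι_comp_toKernel_eq_zero M hM, Category.comp_id, biprod.inr_fst]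
    · rw [biprod.inr_desc_assoc, Category.assoc, biprod.lift_snd,
        kernel_ι_comp_toKernel M ((mul_comm b a).symm ▸ hM) hvu, Category.comp_id, biprod.inr_snd]

end CoprimeSplitting


/-! ## §2 Carrier bookkeeping for `kernel (a • 𝟙 M)` in `C_Γ` -/

namespace DiscreteRep

section Carrier

variable {Γ : Type} [Group Γ] [TopologicalSpace Γ] (M : DiscreteRepCat ℤ Γ)

/-- The underlying map of `kernel.ι` is injective (`kernel.ι` is mono in `C_Γ`, hence in `Rep ℤ Γ`).
[cite: Harari2020, §4.2 (p. 91: `C_G` a full abelian subcategory of `Mod_G`)] -/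
theorem kernel_ι_hom_injective {N : DiscreteRepCat ℤ Γ} (f : M ⟶ N) :
    Function.Injective (kernel.ι f).hom.hom :=
  (Rep.mono_iff_injective ((ι ℤ Γ).map (kernel.ι f))).1 inferInstance

/-- Evaluation of a composite: `(f ≫ g) w = g (f w)` in `C_Γ`. [cite: Harari2020, §4.2] -/
theorem comp_hom_hom_apply {X Y Z : DiscreteRepCat ℤ Γ} (f : X ⟶ Y) (g : Y ⟶ Z) (w : X.obj.V) :
    (f ≫ g).hom.hom w = g.hom.hom (f.hom.hom w) := rfl

/-- The vectors of `kernel (a • 𝟙 M)` are killed by `a` (`ι (a • w) = (a • 𝟙 M) (ι w) = 0`, `ι` injective).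
[cite: Harari2020, §16.3 Theorem 16.21 (proof)] -/
theorem nsmul_eq_zero_of_mem_kernel (a : ℕ) (w : (kernel (a • 𝟙 M)).obj.V) : a • w = 0 := by
  apply kernel_ι_hom_injective M (a • 𝟙 M)
  have h : (kernel.ι (a • 𝟙 M) ≫ (a • 𝟙 M)).hom.hom w = (0 : kernel (a • 𝟙 M) ⟶ M).hom.hom w := by
    rw [kernel.condition]
  rw [comp_hom_hom_apply, nsmul_hom_hom_apply, Nat.cast_smul_eq_nsmul] at h
  rw [map_nsmul, map_zero]
  exact h

/-- The order of `kernel f` divides the order of `M` (Lagrange for the additive subgroup `ι(kernel f)`).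
[cite: Harari2020, §16.3 Theorem 16.21 (proof)] -/
theorem natCard_kernel_dvd {N : DiscreteRepCat ℤ Γ} (f : M ⟶ N) [Finite M.obj.V] :
    Nat.card (kernel f).obj.V ∣ Nat.card M.obj.V := by
  rw [Nat.card_congr (AddMonoidHom.ofInjective (f := ((kernel.ι f).hom.hom : (kernel f).obj.V →+ M.obj.V))
    (kernel_ι_hom_injective M f)).toEquiv]
  exact AddSubgroup.card_addSubgroup_dvd_card _

/-- `kernel f` has finitely many vectors when `M` has. [cite: Harari2020, §16.3 Theorem 16.21 (proof)] -/
theorem finite_kernel {N : DiscreteRepCat ℤ Γ} (f : M ⟶ N) [Finite M.obj.V] :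
    Finite (kernel f).obj.V :=
  Finite.of_injective _ (kernel_ι_hom_injective M f)

/-- **`kernel (b • 𝟙 M)` is a PROPER part of `M` when a prime `ℓ ∣ #M` does not divide `b`**: an element
of order `ℓ` (Cauchy) is not killed by `b`. [cite: Harari2020, §16.3 Theorem 16.21 (proof)] -/
theorem natCard_kernel_lt [Finite M.obj.V] {ℓ : ℕ} (hℓ : ℓ.Prime) (hℓM : ℓ ∣ Nat.card M.obj.V)
    (b : ℕ) (hb : ¬ ℓ ∣ b) : Nat.card (kernel (b • 𝟙 M)).obj.V < Nat.card M.obj.V := by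
  haveI : Fact ℓ.Prime := ⟨hℓ⟩
  have hinj := kernel_ι_hom_injective M (b • 𝟙 M)
  set H : AddSubgroup M.obj.V :=
    ((kernel.ι (b • 𝟙 M)).hom.hom : (kernel (b • 𝟙 M)).obj.V →+ M.obj.V).range with hH
  have hcard : Nat.card (kernel (b • 𝟙 M)).obj.V = Nat.card H :=
    Nat.card_congr (AddMonoidHom.ofInjective hinj).toEquiv
  rw [hcard]
  obtain ⟨x, hx⟩ := exists_prime_addOrderOf_dvd_card' (G := M.obj.V) ℓ hℓM
  have hxH : x ∉ H := by
    rintro ⟨w, rfl⟩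
    have h0 : b • ((kernel.ι (b • 𝟙 M)).hom.hom : (kernel (b • 𝟙 M)).obj.V →+ M.obj.V) w = 0 := by
      rw [← map_nsmul, nsmul_eq_zero_of_mem_kernel M b w, map_zero]
    have hdvd := addOrderOf_dvd_of_nsmul_eq_zero h0
    rw [hx] at hdvd
    exact hb hdvd
  have hne : H ≠ ⊤ := fun h => hxH (h ▸ AddSubgroup.mem_top x)
  have hdvd : Nat.card H ∣ Nat.card M.obj.V := AddSubgroup.card_addSubgroup_dvd_card H
  exact lt_of_le_of_ne (Nat.le_of_dvd Nat.card_pos hdvd) fun h => hne (AddSubgroup.eq_top_of_card_eq H h)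

/-- `#M • 𝟙 M = 0` for a finite `M`. [cite: Harari2020, §16.3 Theorem 16.21 (proof)] -/
theorem natCard_nsmul_id_eq_zero [Finite M.obj.V] : Nat.card M.obj.V • 𝟙 M = 0 :=
  nsmul_id_eq_zero_of_forall M _ fun _ => card_nsmul_eq_zero'

/-- An object of `C_Γ` with one vector is a zero object (any coefficient ring). [cite: Harari2020, §4.2] -/
theorem isZero_of_subsingleton {k : Type} [CommRing k] (X : DiscreteRepCat k Γ) [Subsingleton X.obj.V] :
    IsZero X := by
  rw [IsZero.iff_id_eq_zero]
  exact ObjectProperty.hom_ext _ (Rep.hom_ext (Representation.IntertwiningMap.ext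
    (LinearMap.ext fun v => Subsingleton.elim _ _)))

end Carrier

/-! ## §3 Tate duality for every admissible finite module from the per-prime engines -/

section Main

variable {Γ : Type} [Group Γ] [TopologicalSpace Γ] [IsTopologicalGroup Γ] [CompactSpace Γ]
  [TotallyDisconnectedSpace Γ] (C : DiscreteRepCat ℤ Γ) {Q : Type} [AddCommGroup Q]
  (inv : Ext (triv (k := ℤ) (Γ := Γ) ℤ) C 2 →+ Q)

/-- **Tate duality (Harari Thm. 16.21 / 17.18 for a `P`-class formation; Milne ADT I Thm. 1.8) for EVERY
finite `M ∈ C_Γ` whose order involves only primes `ℓ` at which `TateDualityHypothesesAt ℓ C inv`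
holds**: `α²(Γ, M)` and `α¹(Γ, M)` are bijective and `Ext³_{C_Γ}(M, C) = 0`.  By strong induction on
`#M`: a one-element `M` is a zero object; otherwise, for a prime `ℓ ∣ #M`, `#M = ℓ^k · b` with `ℓ ∤ b`,
`M ≅ kernel (ℓ^k • 𝟙) ⊞ kernel (b • 𝟙)` (`coprimeKernelIso`), the first factor is killed by `ℓ^k`
(engine at `ℓ`: `tateDuality_finite_primary`), the second is a proper part of `M` with `#` dividing
`#M` (induction), and the three conclusions are additive in binary biproducts and invariant under
isomorphism. [cite: Harari2020, §16.3 Theorem 16.21 (proof), Remark 16.24, Theorem 17.18]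
[cite: MilneADT2006, I Theorem 1.8 (proof, p. 22), I Theorem 4.10 (a)] -/
theorem tateDuality_finite_of_primary (M : DiscreteRepCat ℤ Γ) [Finite M.obj.V]
    (hyp : ∀ ℓ : ℕ, ℓ.Prime → ℓ ∣ Nat.card M.obj.V → TateDualityHypothesesAt ℓ C inv) :
    AdjointBijective inv M (show 0 + 2 = 2 from rfl) ∧ AdjointBijective inv M (show 1 + 1 = 2 from rfl) ∧
      ∀ x : Ext M C 3, x = 0 := by
  -- strong induction on the order of `M`
  suffices key : ∀ (n : ℕ) (M : DiscreteRepCat ℤ Γ) [Finite M.obj.V], Nat.card M.obj.V = n →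
      (∀ ℓ : ℕ, ℓ.Prime → ℓ ∣ Nat.card M.obj.V → TateDualityHypothesesAt ℓ C inv) →
      AdjointBijective inv M (show 0 + 2 = 2 from rfl) ∧ AdjointBijective inv M (show 1 + 1 = 2 from rfl) ∧
        ∀ x : Ext M C 3, x = 0 from key _ M rfl hyp
  intro n
  induction n using Nat.strong_induction_on with
  | _ n ih =>
  intro M _ hn hyp
  by_cases h1 : Nat.card M.obj.V = 1
  · -- one vector: zero object
    haveI : Subsingleton M.obj.V := (Nat.card_eq_one_iff_unique.1 h1).1
    have hZ := isZero_of_subsingleton M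
    exact ⟨adjointBijective_of_forall_eq_zero inv _ (fun x => ext_eq_zero_of_isZero_left hZ x)
        (fun y => ext_eq_zero_of_isZero_right hZ y),
      adjointBijective_of_forall_eq_zero inv _ (fun x => ext_eq_zero_of_isZero_left hZ x)
        (fun y => ext_eq_zero_of_isZero_right hZ y),
      fun x => ext_eq_zero_of_isZero_left hZ x⟩
  · -- a prime `ℓ ∣ #M`; split `#M = ℓ^k · b`, `ℓ ∤ b`
    have hN0 : Nat.card M.obj.V ≠ 0 := Nat.card_pos.ne'
    set N := Nat.card M.obj.V with hNdef
    have hℓ : (Nat.minFac N).Prime := Nat.minFac_prime h1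
    set ℓ := Nat.minFac N with hℓdef
    have hℓN : ℓ ∣ N := Nat.minFac_dvd N
    set a := ℓ ^ N.factorization ℓ with hadef
    set b := N / a with hbdef
    have hab : a * b = N := Nat.ordProj_mul_ordCompl_eq_self N ℓ
    have hcop : Nat.Coprime a b := (Nat.coprime_ordCompl hℓ hN0).pow_left _
    have hbℓ : ¬ ℓ ∣ b := Nat.not_dvd_ordCompl hℓ hN0
    obtain ⟨u, v, huv⟩ := hcop.isCoprime
    have hM : (a * b) • 𝟙 M = 0 := by rw [hab]; exact natCard_nsmul_id_eq_zero M
    let e := CoprimeSplitting.coprimeKernelIso M hM huv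
    -- the `ℓ`-primary factor: engine at `ℓ`
    haveI : Finite (kernel (a • 𝟙 M)).obj.V := finite_kernel M _
    haveI : Finite (kernel (b • 𝟙 M)).obj.V := finite_kernel M _
    have hA := tateDuality_finite_primary (hyp ℓ hℓ hℓN) (kernel (a • 𝟙 M))
      (N.factorization ℓ) (nsmul_eq_zero_of_mem_kernel M a)
    -- the coprime factor: induction
    have hB := ih (Nat.card (kernel (b • 𝟙 M)).obj.V) (hn ▸ natCard_kernel_lt M hℓ hℓN b hbℓ)
      (kernel (b • 𝟙 M)) rfl
      (fun ℓ' hℓ' hdvd => hyp ℓ' hℓ' (hdvd.trans (natCard_kernel_dvd M _)))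
    exact ⟨(adjointBijective_iff_of_iso inv e _).2 ((adjointBijective_biprod_iff inv _ _ _).2 ⟨hA.1, hB.1⟩),
      (adjointBijective_iff_of_iso inv e _).2 ((adjointBijective_biprod_iff inv _ _ _).2 ⟨hA.2.1, hB.2.1⟩),
      fun x => ext_eq_zero_of_iso e ((ext_biprod_eq_zero_iff _ _).2 ⟨hA.2.2, hB.2.2⟩) x⟩

/-- **The `r = 1` input of Poitou–Tate for `G_S` (Milne I 4.10 (b)), all admissible `M` at once**:
under the per-prime hypotheses at every `ℓ ∣ #M`, `α¹(Γ, M) : Ext¹(M, C) → Hom(Ext¹(ℤ, M), Q)` is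
injective. [cite: Harari2020, Theorem 17.18] [cite: MilneADT2006, I Theorem 1.8 (b), Theorem 4.10 (proof)] -/
theorem adjointMap_one_injective_of_primary (M : DiscreteRepCat ℤ Γ) [Finite M.obj.V]
    (hyp : ∀ ℓ : ℕ, ℓ.Prime → ℓ ∣ Nat.card M.obj.V → TateDualityHypothesesAt ℓ C inv) :
    Function.Injective (adjointMap inv M (show 1 + 1 = 2 from rfl)) :=
  (tateDuality_finite_of_primary C inv M hyp).2.1.1

end Main

end DiscreteRep

end Literature.Algebra.Homology

end
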